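import Mathlib
import HarnessLib
import Summits.RiemannHypothesis.RiemannHypothesis.Theorems.IntegerScrewSmoothRoughSplit

/-!
# Route `IntegerScrew` — the harmonic mass of the `Q`-rough hubs (PROPOSITION K″, CONTINUUM-LIMIT §27.1)

PROP. K″ routes the bottom mass of a thin-bottom window `(Q, R]` through the HUBS: the numbers `P ∈ (Q, R/Q]` all of
whose prime factors exceed `Q`.  The energy of the hub flow is inversely proportional to the hub mass
`M = Σ_P 1/P`, and this file gives its elementary lower bound

* (private) `sum_inv_smooth_le_prod'` — `Σ_{m ≤ X, m k-smooth} 1/m ≤ Π_{p<k}(1 − 1/p)⁻¹` (Mathlib's Euler product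
  over the smooth numbers, weight `1/n`; = the tree's `IntegerScrew.sum_inv_smooth_le_prod`);
* `sum_inv_rough_Icc_le_one` — below `Q` the only `(Q+1)`-rough number is `1`;
* **`hubMass_ge`** — `Σ_{P ∈ (Q, Y], P (Q+1)-rough} 1/P ≥ H_Y/Π_{p ≤ Q}(1 − 1/p)⁻¹ − 1`;
* **`hubMass_ge_log`** — the same with `H_Y ≥ log(Y+1)`.

(With Mertens' product bound `Π_{p≤Q}(1 − 1/p)⁻¹ ≤ e^{γ+o(1)} log Q` this is `M ≥ log Y/(C log Q) − 1`, §27.1.)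
RH-free, elementary.  Nothing in this file bears on the truth of RH.
References: CONTINUUM-LIMIT §27.1 (rh-explicit A6-PIVOT); M. Suzuki, J. Lond. Math. Soc. (2) 108 (2023) 1448–1487
[Suzuki2023] for the screw matrices this serves; G. Tenenbaum, GSM 163 (2015) Ch. III.5 for the smooth-number sum.
-/

noncomputable section

set_option linter.dupNamespace false -- D-0017: `Summit.<S>.<S>.…` is the designed namespace

namespace Summit.RiemannHypothesis.RiemannHypothesis.Theorems.IntegerScrew

open Finset

/-- **Euler-product bound for the harmonic sum of the smooth numbers**: `Σ_{m ≤ X, m k-smooth} 1/m ≤ Π_{p<k}(1 − 1/p)⁻¹`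
(Mathlib's Euler product over the smooth numbers for the completely multiplicative weight `n ↦ 1/n`; the case `σ = 0`
of `Literature.NumberTheory.Multiplicative.SmoothRankin.sum_rpow_smooth_le_prod`; a private copy of the tree's
`IntegerScrew.sum_inv_smooth_le_prod` of `IntegerScrewWalkPoincareMertens`, to be replaced by an import of that
module). -/
private theorem sum_inv_smooth_le_prod' (k X : ℕ) :
    ∑ m ∈ (Icc 1 X).filter (· ∈ Nat.smoothNumbers k), (1 : ℝ) / m ≤
      ∏ p ∈ k.primesBelow, (1 - (1 : ℝ) / p)⁻¹ := by
  let f : ℕ →* ℝ :=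
    { toFun := fun n => (1 : ℝ) / n
      map_one' := by simp
      map_mul' := fun m n => by push_cast; rw [one_div_mul_one_div] }
  have hf : ∀ n : ℕ, f n = (1 : ℝ) / n := fun _ => rfl
  have hlt : ∀ {p : ℕ}, p.Prime → ‖f p‖ < 1 := by
    intro p hp
    have hp1 : (1 : ℝ) < p := by exact_mod_cast hp.one_lt
    rw [hf, Real.norm_eq_abs, abs_of_nonneg (by positivity), div_lt_one (by linarith)]
    exact hp1
  obtain ⟨-, hsum⟩ := EulerProduct.summable_and_hasSum_smoothNumbers_prod_primesBelow_geometric hlt k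
  have hind : HasSum ((Nat.smoothNumbers k).indicator (fun n : ℕ => (f n : ℝ)))
      (∏ p ∈ k.primesBelow, (1 - f p)⁻¹) := hasSum_subtype_iff_indicator.1 hsum
  have hnn : ∀ n, 0 ≤ (Nat.smoothNumbers k).indicator (fun n : ℕ => (f n : ℝ)) n := by
    intro n
    by_cases hn : n ∈ Nat.smoothNumbers k
    · rw [Set.indicator_of_mem hn, hf]; positivity
    · rw [Set.indicator_of_notMem hn]
  have hle := sum_le_hasSum (Icc 1 X) (fun n _ => hnn n) hind
  have hlhs : ∑ m ∈ (Icc 1 X).filter (· ∈ Nat.smoothNumbers k), (1 : ℝ) / m =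
      ∑ n ∈ Icc 1 X, (Nat.smoothNumbers k).indicator (fun n : ℕ => (f n : ℝ)) n := by
    rw [Finset.sum_filter]
    refine Finset.sum_congr rfl fun n _ => ?_
    by_cases hn : n ∈ Nat.smoothNumbers k
    · rw [if_pos hn, Set.indicator_of_mem hn, hf]
    · rw [if_neg hn, Set.indicator_of_notMem hn]
  have hrhs : ∏ p ∈ k.primesBelow, (1 - f p)⁻¹ = ∏ p ∈ k.primesBelow, (1 - (1 : ℝ) / p)⁻¹ :=
    Finset.prod_congr rfl fun p _ => by rw [hf]
  rw [hlhs, ← hrhs]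
  exact hle

/-- Below `Q` the only number all of whose prime factors exceed `Q` is `1`:
`Σ_{r ≤ Q, every prime of r ≥ Q+1} 1/r ≤ 1`. -/
theorem sum_inv_rough_Icc_le_one (Q : ℕ) :
    ∑ r ∈ (Icc 1 Q).filter (fun r => ∀ q ∈ r.primeFactors, Q + 1 ≤ q), (1 : ℝ) / r ≤ 1 := by
  have hsub : (Icc 1 Q).filter (fun r => ∀ q ∈ r.primeFactors, Q + 1 ≤ q) ⊆ {1} := by
    intro r hr
    rw [Finset.mem_filter, Finset.mem_Icc] at hr
    rw [Finset.mem_singleton]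
    by_contra hne
    have hr2 : 2 ≤ r := by omega
    obtain ⟨q, hq, hqr⟩ := Nat.exists_prime_and_dvd (show r ≠ 1 from hne)
    have hqm : q ∈ r.primeFactors := Nat.mem_primeFactors.2 ⟨hq, hqr, by omega⟩
    have h1 := hr.2 q hqm
    have h2 : q ≤ r := Nat.le_of_dvd (by omega) hqr
    omega
  calc ∑ r ∈ (Icc 1 Q).filter (fun r => ∀ q ∈ r.primeFactors, Q + 1 ≤ q), (1 : ℝ) / r
      ≤ ∑ r ∈ ({1} : Finset ℕ), (1 : ℝ) / r :=
        Finset.sum_le_sum_of_subset_of_nonneg hsub fun r _ _ => by positivity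
    _ = 1 := by simp

/-- **The hub mass from below** (CONTINUUM-LIMIT §27.1): for `Q ≤ Y`,
`Σ_{P ∈ (Q, Y], every prime of P ≥ Q+1} 1/P ≥ H_Y/Π_{p<Q+1}(1 − 1/p)⁻¹ − 1`. -/
theorem hubMass_ge {Q Y : ℕ} (hQY : Q ≤ Y) :
    (∑ n ∈ Icc 1 Y, (1 : ℝ) / n) / (∏ p ∈ (Q + 1).primesBelow, (1 - (1 : ℝ) / p)⁻¹) - 1 ≤
      ∑ P ∈ (Ioc Q Y).filter (fun r => ∀ q ∈ r.primeFactors, Q + 1 ≤ q), (1 : ℝ) / P := by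
  rcases Nat.eq_zero_or_pos Y with hY0 | hY
  · subst hY0
    have hQ0 : Q = 0 := by omega
    subst hQ0
    simp
  set S := ∑ m ∈ (Icc 1 Y).filter (· ∈ Nat.smoothNumbers (Q + 1)), (1 : ℝ) / m with hS
  set Pr := ∏ p ∈ (Q + 1).primesBelow, (1 - (1 : ℝ) / p)⁻¹ with hPr
  have h1S : 1 ∈ (Icc 1 Y).filter (· ∈ Nat.smoothNumbers (Q + 1)) := by
    refine Finset.mem_filter.2 ⟨Finset.mem_Icc.2 ⟨le_rfl, hY⟩, ?_⟩
    exact Nat.mem_smoothNumbers'.2 fun p hp hd => absurd (Nat.eq_one_of_dvd_one hd ▸ hp) Nat.not_prime_one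
  have hSpos : 0 < S := Finset.sum_pos' (fun m hm => by positivity) ⟨1, h1S, by norm_num⟩
  have hSPr : S ≤ Pr := sum_inv_smooth_le_prod' (Q + 1) Y
  have hH0 : 0 ≤ ∑ n ∈ Icc 1 Y, (1 : ℝ) / n := Finset.sum_nonneg fun n _ => by positivity
  -- split the rough sum at Q
  have hsplit : ∑ r ∈ (Icc 1 Y).filter (fun r => ∀ q ∈ r.primeFactors, Q + 1 ≤ q), (1 : ℝ) / r =
      ∑ r ∈ (Icc 1 Q).filter (fun r => ∀ q ∈ r.primeFactors, Q + 1 ≤ q), (1 : ℝ) / r +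
        ∑ P ∈ (Ioc Q Y).filter (fun r => ∀ q ∈ r.primeFactors, Q + 1 ≤ q), (1 : ℝ) / P := by
    rw [← Finset.sum_union]
    · congr 1
      rw [← Finset.filter_union]
      congr 1
      ext r; simp only [Finset.mem_union, Finset.mem_Icc, Finset.mem_Ioc]; omega
    · exact Finset.disjoint_filter_filter (Finset.disjoint_left.2 fun r h1 h2 => by
        rw [Finset.mem_Icc] at h1; rw [Finset.mem_Ioc] at h2; omega)
  have hmain := sum_inv_rough_ge (k := Q + 1) hY
  rw [hsplit] at hmain
  have hle1 := sum_inv_rough_Icc_le_one Q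
  have hdiv : (∑ n ∈ Icc 1 Y, (1 : ℝ) / n) / Pr ≤ (∑ n ∈ Icc 1 Y, (1 : ℝ) / n) / S :=
    div_le_div_of_nonneg_left hH0 hSpos hSPr
  linarith

/-- **The hub mass from below, logarithmic form**: for `Q ≤ Y`,
`Σ_{P ∈ (Q, Y], every prime of P ≥ Q+1} 1/P ≥ log(Y+1)/Π_{p<Q+1}(1 − 1/p)⁻¹ − 1`. -/
theorem hubMass_ge_log {Q Y : ℕ} (hQY : Q ≤ Y) :
    Real.log ((Y : ℝ) + 1) / (∏ p ∈ (Q + 1).primesBelow, (1 - (1 : ℝ) / p)⁻¹) - 1 ≤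
      ∑ P ∈ (Ioc Q Y).filter (fun r => ∀ q ∈ r.primeFactors, Q + 1 ≤ q), (1 : ℝ) / P := by
  refine le_trans ?_ (hubMass_ge hQY)
  have hprod : 0 < ∏ p ∈ (Q + 1).primesBelow, (1 - (1 : ℝ) / p)⁻¹ := by
    refine Finset.prod_pos fun p hp => ?_
    have hp2 : (2 : ℝ) ≤ p := by exact_mod_cast (Nat.mem_primesBelow.1 hp).2.two_le
    have : (1 : ℝ) / p ≤ 1 / 2 := by
      rw [div_le_div_iff₀ (by linarith) (by norm_num)]; linarith
    have : 0 < 1 - (1 : ℝ) / p := by linarith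
    positivity
  have hlog : Real.log ((Y : ℝ) + 1) ≤ ∑ n ∈ Icc 1 Y, (1 : ℝ) / n := by
    have h := log_add_one_le_harmonic Y
    rw [harmonic_eq_sum_Icc] at h
    push_cast at h
    simpa [one_div] using h
  linarith [div_le_div_of_nonneg_right hlog hprod.le]

end Summit.RiemannHypothesis.RiemannHypothesis.Theorems.IntegerScrew

end
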